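import Literature.AlgebraicGeometry.Frobenioids.PadicKummerRemark242Saturated
import Literature.AlgebraicGeometry.Frobenioids.PadicKummerSaturatedPullback
import HarnessLib

/-!
# Frobenioids II, Remark 2.4.2: hypothesis-free EXISTENCE of the counterexample to Theorem 2.4 (ii)'s
# conclusion over every non-archimedean local field of characteristic zero

Proof-only capstone (abc-iut cell, layer L1, seat abc-iut-w5-d248 gen 2; SUBDAG-FrdII-Thm24 row L26)
combining `PadicKummerRemark242Saturated.lean` (p420882) with abc-iut-L1-t7's existence of
`(N, H)`-saturated objects at the arithmetic binding (`exists_isNHSaturated_ofLocalField`,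
`PadicKummerSaturatedPullback.lean` — [FrdII] Remark 2.2.1 p. 18).

S. Mochizuki, *The geometry of Frobenioids II*, Kyushu J. Math. **62** (2008), Rmk. 2.2.1 p. 18,
Thm. 2.4 pp. 19–20, Rmk. 2.4.2 p. 22 [cite: MochizukiFrdII2008, Rmk 2.4.2 p.22].

* `Def22Context.rmk242_vs_thm24_exists` — for EVERY non-archimedean local field `K` of
  characteristic `0`, finite `L′ ⊆ K̄`, open normal `H ⊆ G_K` and `N > 2`, there is a finite Galois
  `L ⊇ L′` such that, at the arithmetic context `ofLocalField L H hH O^×_L` (`O^□ = O^×`): `A` is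
  `(N, H)`-saturated, an isomorphism `inv : F_N(A) ⥲ ℤ/Nℤ` exists, and an automorphism of the
  Definition 2.2 data (identity on `Aut_E(A_E)`) has comparison data satisfying Theorem 2.4 (i) with
  the cup-product duality isomorphism on both sides (every `p`, `fs`) and the action clause, which are
  `InvariantIncompatible` for every `F_N(A) ⥲ ℤ/Nℤ` — so the conclusion of Theorem 2.4 (ii) fails.
  NO hypothesis beyond `2 < N`.

No new definitions; nothing here concerns [IUTchIII].
-/

namespace Literature.AlgebraicGeometry.Frobenioids

namespace PadicKummer

namespace Def22Context

open Kummer Field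
open Literature.AnabelianGeometry.AbsoluteAnabelian (unitSubmonoid)

variable {K : Type} [Field K] [ValuativeRel K] [TopologicalSpace K] [IsNonarchimedeanLocalField K]
  [CharZero K]

/-- **Remark 2.4.2 as a hypothesis-free existence statement** (FrdII pp. 18–22): over every
non-archimedean local field `K` of characteristic `0`, for every finite `L′ ⊆ K̄`, open normal
`H ⊆ G_K` and `N > 2`, some finite Galois `L ⊇ L′` carries, at the arithmetic context with
`O^□ = O^×_L`, an `(N, H)`-saturated object with `F_N(A) ⥲ ℤ/Nℤ` and Ψ-data satisfying Theorem 2.4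
(i) (cup-product duality isomorphism on both sides) and its action clause but NOT the conclusion of
Theorem 2.4 (ii). [cite: MochizukiFrdII2008, Rmk 2.4.2 p.22] -/
theorem rmk242_vs_thm24_exists (L' : IntermediateField K (AlgebraicClosure K))
    [FiniteDimensional K L'] (H : Subgroup (absoluteGaloisGroup K)) [H.Normal]
    (hH : IsOpen (H : Set (absoluteGaloisGroup K))) (N : ℕ) (hN : 2 < N) :
    ∃ (L : IntermediateField K (AlgebraicClosure K)) (_ : FiniteDimensional K L) (_ : IsGalois K L),
      L' ≤ L ∧
      ∃ (_ : NeZero N) (h : IsNHSaturated (ofLocalField L H hH (unitsStableSubmonoid K L)) N)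
        (inv : FNInvariant (ofLocalField L H hH (unitsStableSubmonoid K L)) N)
        (e : Def22Context.Iso (ofLocalField L H hH (unitsStableSubmonoid K L))
          (ofLocalField L H hH (unitsStableSubmonoid K L))),
        (∀ τ, e.isoE τ = τ) ∧
        (∀ (p : ℕ) (fs : Prop), Thm24i _ _ N p p fs fs (e.thm24Data N)
          (dualityIsoOfLocalField L H hH (unitsStableSubmonoid K L) N
            (unitsStableSubmonoid_mem_of_pow_eq_one L N) h)
          (dualityIsoOfLocalField L H hH (unitsStableSubmonoid K L) N
            (unitsStableSubmonoid_mem_of_pow_eq_one L N) h)) ∧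
        Thm24iActionCompat _ _ N (e.thm24Data N) ∧
        (∀ inv' : FNInvariant (ofLocalField L H hH (unitsStableSubmonoid K L)) N,
          InvariantIncompatible _ _ N (e.thm24Data N) inv' inv') ∧
        ¬ Thm24ii _ _ N True True (e.thm24Data N) inv inv := by
  haveI hNZ : NeZero N := ⟨by omega⟩
  obtain ⟨L, hfd, hgal, hle, hsat⟩ := exists_isNHSaturated_ofLocalField L' H hH N
  haveI := hfd
  haveI := hgal
  have h : IsNHSaturated (ofLocalField L H hH (unitsStableSubmonoid K L)) N :=
    hsat (unitsStableSubmonoid K L) (unitsStableSubmonoid_mem_of_pow_eq_one L N)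
  obtain ⟨inv, e, hE, hi, hact, hinc, hnot⟩ :=
    rmk242_vs_thm24_ofLocalField_saturated L H hH N hN h
  exact ⟨L, hfd, hgal, hle, hNZ, h, inv, e, hE, hi, hact, hinc, hnot⟩

end Def22Context

end PadicKummer

end Literature.AlgebraicGeometry.Frobenioids
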